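import Summits.CriticalPhenomena.PercolationContinuityZ3.Theorems.Transplant.GrigorchukPowerResolventBounds
import HarnessLib

/-!
# W4 S3b-γ (first file) «GreenComparison»: the antitone inverse by a completed square, and the regularised Green operator `(c(1 − P_L) + m)⁻¹ ≼ c⁻¹ 𝒢_L`

Proof file (`--supports stmt-CriticalPhenomena-4575 --as helper`), lane `prim-bschramm`, seat `prim-bschramm-gen-1` gen 13 (GEN pen); item γ of P3-NILPOTENT §39 (39.2),
first half = (γ1) + (γ2) (HOLD/GATED on β ACCEPTED + the lead's line — typed ahead, filed only when opened):
* (γ1) **`inner_inverse_le_of_forms_le`**: for units `Y, Z` of `ℓ² →L[ℝ] ℓ²` with `Y† = Y`, `Y ≽ 0` and `⟪η, Yη⟫ ≤ ⟪η, Zη⟫` for all `η`: `⟪f, Z⁻¹ f⟫ ≤ ⟪f, Y⁻¹ f⟫`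
  (completed square `2⟪f,g⟫ − ⟪g,Yg⟫ = ⟪u,f⟫ − ⟪g − u, Y(g − u)⟫`, `g = Z⁻¹f`, `u = Y⁻¹f`; no supremum, no spectral theorem);
* (γ2) for `c, m > 0` the regularised Green operator `Y = (c + m)·1 − c·P_L` has the explicit Neumann inverse `(c+m)⁻¹ Σ_n (r P_L)^n`, `r = c/(c+m)`, and
  **`ofReal_inner_greenRegInv_le`**: `ENNReal.ofReal ⟪toL2 f, Y⁻¹ (toL2 f)⟫ ≤ ENNReal.ofReal c⁻¹ * greenForm (gkCay k) f` (termwise `0 ≤ r^n ⟪f, P_L^n f⟫ ≤ ⟪f, P_L^n f⟫`,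
  α `inner_lazyOp_pow_nonneg` / `greenForm_eq_tsum_inner`; critic P-37-b);
* the `θ ↓ 0` bookkeeping lemma `le_mul_of_forall_lt_one`.
Serves S3b′ `stub_fBoot_le_of_laceBound` (v1.8 :80); ASSERTS NOTHING about it or S3a′.  builds on p205010 (kernel theorem, internal audit signed; external expert review
pending) — nothing here uses p205010.  Def-free; no instance, no notation, no sorry.
[cite: HeydenreichVanDerHofstad2017, Lemma 8.12 ((8.4.22)–(8.4.29)), §5.2 (the lazy Green operator)]
-/

noncomputable section

namespace Summit.CriticalPhenomena.PercolationContinuityZ3.Theorems.Transplant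

namespace Grigorchuk

namespace NcHaraSlade

open SimpleGraph Literature.Probability.Percolation Literature.Barriers.CriticalPhenomena
open scoped ENNReal Classical InnerProductSpace

variable {k : ℕ}

/-! ## §1 (γ1) The antitone inverse by a completed square -/

/-- **`⟪f, Z⁻¹ f⟫ ≤ ⟪f, Y⁻¹ f⟫` when `0 ≼ Y ≼ Z`** for units `Y, Z` of the operator ring with `Y` self-adjoint: with `g = Z⁻¹f`, `u = Y⁻¹f`,
`⟪f, Z⁻¹f⟫ = 2⟪f,g⟫ − ⟪g,Zg⟫ ≤ 2⟪f,g⟫ − ⟪g,Yg⟫ = ⟪f, Y⁻¹f⟫ − ⟪g − u, Y(g − u)⟫ ≤ ⟪f, Y⁻¹f⟫`. [cite: HeydenreichVanDerHofstad2017, Lemma 8.12 (the form comparison)] -/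
theorem inner_inverse_le_of_forms_le (Y Z : lp (fun _ : GPow k => ℝ) 2 →L[ℝ] lp (fun _ : GPow k => ℝ) 2) (hY : IsUnit Y) (hZ : IsUnit Z)
    (hYsa : ContinuousLinearMap.adjoint Y = Y) (hYpos : ∀ v, 0 ≤ ⟪v, Y v⟫_ℝ) (hle : ∀ η, ⟪η, Y η⟫_ℝ ≤ ⟪η, Z η⟫_ℝ) (f : lp (fun _ : GPow k => ℝ) 2) :
    ⟪f, Ring.inverse Z f⟫_ℝ ≤ ⟪f, Ring.inverse Y f⟫_ℝ := by
  set g := Ring.inverse Z f with hg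
  set u := Ring.inverse Y f with hu
  have hZg : Z g = f := by rw [hg, ← mul_apply_eq_comp, Ring.mul_inverse_cancel _ hZ, one_apply_eq_self]
  have hYu : Y u = f := by rw [hu, ← mul_apply_eq_comp, Ring.mul_inverse_cancel _ hY, one_apply_eq_self]
  have h1 : ⟪g, Z g⟫_ℝ = ⟪f, g⟫_ℝ := by rw [hZg, real_inner_comm]
  have h2 : ⟪g, Y u⟫_ℝ = ⟪f, g⟫_ℝ := by rw [hYu, real_inner_comm]
  have h3 : ⟪u, Y g⟫_ℝ = ⟪f, g⟫_ℝ := by rw [← ContinuousLinearMap.adjoint_inner_left, hYsa, hYu]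
  have h4 : ⟪u, Y u⟫_ℝ = ⟪f, u⟫_ℝ := by rw [hYu, real_inner_comm]
  have hsq : ⟪g - u, Y (g - u)⟫_ℝ = ⟪g, Y g⟫_ℝ - 2 * ⟪f, g⟫_ℝ + ⟪f, u⟫_ℝ := by
    rw [map_sub, inner_sub_left, inner_sub_right, inner_sub_right, h2, h3, h4]; ring
  have h5 := hYpos (g - u)
  have h6 := hle g
  linarith

/-! ## §2 (γ2) The regularised Green operator and its comparison with `𝒢_L` -/

/-- `‖P_L‖ ≤ 1` (`k ≥ 1`). [cite: HeydenreichVanDerHofstad2017, §5.2] -/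
theorem norm_lazyOp_le (hk : 1 ≤ k) : ‖lazyOp k‖ ≤ 1 := by
  have h1 : ‖(1 : lp (fun _ : GPow k => ℝ) 2 →L[ℝ] lp (fun _ : GPow k => ℝ) 2)‖ ≤ 1 := by
    rw [ContinuousLinearMap.one_def]; exact ContinuousLinearMap.norm_id_le
  unfold lazyOp
  calc ‖(1 / 2 : ℝ) • ((1 : lp (fun _ : GPow k => ℝ) 2 →L[ℝ] lp (fun _ : GPow k => ℝ) 2) + srwOp k)‖
      ≤ ‖(1 / 2 : ℝ)‖ * ‖(1 : lp (fun _ : GPow k => ℝ) 2 →L[ℝ] lp (fun _ : GPow k => ℝ) 2) + srwOp k‖ := (norm_smul _ _).le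
    _ ≤ (1 / 2 : ℝ) * (1 + 1) := by
        rw [Real.norm_eq_abs, abs_of_pos (by norm_num : (0 : ℝ) < 1 / 2)]
        exact mul_le_mul_of_nonneg_left ((norm_add_le _ _).trans (add_le_add h1 (norm_srwOp_le hk))) (by norm_num)
    _ = 1 := by norm_num

/-- `‖r • P_L‖ < 1` for `0 ≤ r < 1` (`k ≥ 1`). [folklore] -/
theorem norm_smul_lazyOp_lt_one (hk : 1 ≤ k) {r : ℝ} (hr0 : 0 ≤ r) (hr : r < 1) : ‖r • lazyOp k‖ < 1 := by
  rw [norm_smul, Real.norm_eq_abs, abs_of_nonneg hr0]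
  exact lt_of_le_of_lt (mul_le_of_le_one_right hr0 (norm_lazyOp_le hk)) hr

/-- The regularised Green operator factored: `(c+m)·1 − c·P_L = (c+m) · (1 − r P_L)`, `r = c/(c+m)`. [folklore] -/
theorem greenReg_eq (c m : ℝ) (hcm : c + m ≠ 0) :
    (c + m) • (1 : lp (fun _ : GPow k => ℝ) 2 →L[ℝ] lp (fun _ : GPow k => ℝ) 2) - c • lazyOp k = (c + m) • (1 - (c / (c + m)) • lazyOp k) := by
  rw [smul_sub, smul_smul, mul_div_cancel₀ _ hcm]

/-- **The Neumann inverse of the regularised Green operator**: `Y W = 1 = W Y` with `W = (c+m)⁻¹ Σ_n (r P_L)^n`. [cite: HeydenreichVanDerHofstad2017, §5.2 (𝒢 as a Neumann series)] -/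
theorem greenReg_mul_inv (hk : 1 ≤ k) {c m : ℝ} (hc : 0 < c) (hm : 0 < m) :
    ((c + m) • (1 : lp (fun _ : GPow k => ℝ) 2 →L[ℝ] lp (fun _ : GPow k => ℝ) 2) - c • lazyOp k) *
        ((c + m)⁻¹ • ∑' n : ℕ, ((c / (c + m)) • lazyOp k) ^ n) = 1 ∧
      ((c + m)⁻¹ • ∑' n : ℕ, ((c / (c + m)) • lazyOp k) ^ n) *
        ((c + m) • (1 : lp (fun _ : GPow k => ℝ) 2 →L[ℝ] lp (fun _ : GPow k => ℝ) 2) - c • lazyOp k) = 1 := by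
  have hcm : 0 < c + m := by linarith
  have hr : ‖(c / (c + m)) • lazyOp k‖ < 1 := norm_smul_lazyOp_lt_one hk (by positivity) ((div_lt_one hcm).2 (by linarith))
  rw [greenReg_eq c m hcm.ne']
  constructor
  · rw [smul_mul_smul_comm, mul_inv_cancel₀ hcm.ne', one_smul, mul_neg_geom_series _ hr]
  · rw [smul_mul_smul_comm, inv_mul_cancel₀ hcm.ne', one_smul, geom_series_mul_neg _ hr]

/-- The regularised Green operator is a unit. [folklore] -/
theorem isUnit_greenReg (hk : 1 ≤ k) {c m : ℝ} (hc : 0 < c) (hm : 0 < m) :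
    IsUnit ((c + m) • (1 : lp (fun _ : GPow k => ℝ) 2 →L[ℝ] lp (fun _ : GPow k => ℝ) 2) - c • lazyOp k) :=
  isUnit_iff_exists.2 ⟨_, (greenReg_mul_inv hk hc hm).1, (greenReg_mul_inv hk hc hm).2⟩

/-- `Ring.inverse` of the regularised Green operator is the Neumann series. [folklore] -/
theorem inverse_greenReg (hk : 1 ≤ k) {c m : ℝ} (hc : 0 < c) (hm : 0 < m) :
    Ring.inverse ((c + m) • (1 : lp (fun _ : GPow k => ℝ) 2 →L[ℝ] lp (fun _ : GPow k => ℝ) 2) - c • lazyOp k) =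
      (c + m)⁻¹ • ∑' n : ℕ, ((c / (c + m)) • lazyOp k) ^ n := by
  have hu := isUnit_greenReg hk hc hm
  obtain ⟨h1, -⟩ := greenReg_mul_inv hk hc hm
  set Y := (c + m) • (1 : lp (fun _ : GPow k => ℝ) 2 →L[ℝ] lp (fun _ : GPow k => ℝ) 2) - c • lazyOp k with hY
  set W := (c + m)⁻¹ • ∑' n : ℕ, ((c / (c + m)) • lazyOp k) ^ n with hW
  calc Ring.inverse Y = Ring.inverse Y * (Y * W) := by rw [h1, mul_one]
    _ = (Ring.inverse Y * Y) * W := (mul_assoc _ _ _).symm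
    _ = W := by rw [Ring.inverse_mul_cancel _ hu, one_mul]

/-- The regularised Green operator is self-adjoint. [folklore] -/
theorem adjoint_greenReg (c m : ℝ) :
    ContinuousLinearMap.adjoint ((c + m) • (1 : lp (fun _ : GPow k => ℝ) 2 →L[ℝ] lp (fun _ : GPow k => ℝ) 2) - c • lazyOp k) =
      (c + m) • (1 : lp (fun _ : GPow k => ℝ) 2 →L[ℝ] lp (fun _ : GPow k => ℝ) 2) - c • lazyOp k := by
  rw [map_sub, map_smulₛₗ ContinuousLinearMap.adjoint, map_smulₛₗ ContinuousLinearMap.adjoint, starRingEnd_apply, starRingEnd_apply, star_trivial, star_trivial,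
    ContinuousLinearMap.adjoint_one, adjoint_lazyOp]

/-- `⟪η, Y η⟫ = (c+m)‖η‖² − c ⟪η, P_L η⟫`. [folklore] -/
theorem inner_greenReg_eq (c m : ℝ) (η : lp (fun _ : GPow k => ℝ) 2) :
    ⟪η, ((c + m) • (1 : lp (fun _ : GPow k => ℝ) 2 →L[ℝ] lp (fun _ : GPow k => ℝ) 2) - c • lazyOp k) η⟫_ℝ = (c + m) * ‖η‖ ^ 2 - c * ⟪η, lazyOp k η⟫_ℝ := by
  rw [sub_apply, FunLike.coe_smul, FunLike.coe_smul, Pi.smul_apply, Pi.smul_apply, one_apply_eq_self, inner_sub_right, real_inner_smul_right,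
    real_inner_smul_right, real_inner_self_eq_norm_sq]

/-- **`⟪η, Y η⟫ ≥ m ‖η‖²`** and in particular `Y ≽ 0` (`⟪η, P_L η⟫ ≤ ‖η‖²`, `k ≥ 1`). [folklore] -/
theorem inner_greenReg_ge (hk : 1 ≤ k) {c m : ℝ} (hc : 0 ≤ c) (η : lp (fun _ : GPow k => ℝ) 2) :
    m * ‖η‖ ^ 2 ≤ ⟪η, ((c + m) • (1 : lp (fun _ : GPow k => ℝ) 2 →L[ℝ] lp (fun _ : GPow k => ℝ) 2) - c • lazyOp k) η⟫_ℝ := by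
  rw [inner_greenReg_eq]
  have h := inner_lazyOp_le hk η
  nlinarith

/-- **(γ2) `ofReal ⟪f, Y⁻¹ f⟫ ≤ c⁻¹ · greenForm f`** for the regularised Green operator `Y = c(1 − P_L) + m` (`c, m > 0`, `k ≥ 1`), on finitely supported `f`:
`Y⁻¹ = Σ_n r^n P_L^n/(c+m)`, `0 ≤ r^n⟪f, P_L^n f⟫ ≤ ⟪f, P_L^n f⟫`, and `greenForm f = Σ_n ofReal ⟪f, P_L^n f⟫` (α (L2); critic P-37-b).
[cite: HeydenreichVanDerHofstad2017, §5.2, Lemma 8.12] -/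
theorem ofReal_inner_greenRegInv_le (hk : 1 ≤ k) {c m : ℝ} (hc : 0 < c) (hm : 0 < m) (f : GPow k →₀ ℝ) :
    ENNReal.ofReal ⟪toL2 f, Ring.inverse ((c + m) • (1 : lp (fun _ : GPow k => ℝ) 2 →L[ℝ] lp (fun _ : GPow k => ℝ) 2) - c • lazyOp k) (toL2 f)⟫_ℝ ≤
      ENNReal.ofReal c⁻¹ * greenForm (gkCay k) f := by
  have hcm : 0 < c + m := by linarith
  set r : ℝ := c / (c + m) with hr
  have hr0 : 0 ≤ r := by positivity
  have hr1 : r < 1 := (div_lt_one hcm).2 (by linarith)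
  have hrn : ‖r • lazyOp k‖ < 1 := norm_smul_lazyOp_lt_one hk hr0 hr1
  set η := toL2 f with hη
  -- the Neumann series applied and paired with `η`
  have hS : Summable fun n : ℕ => (r • lazyOp k) ^ n := summable_geometric_of_norm_lt_one hrn
  have hSη : HasSum (fun n : ℕ => ⟪η, ((r • lazyOp k) ^ n) η⟫_ℝ) ⟪η, (∑' n : ℕ, (r • lazyOp k) ^ n) η⟫_ℝ := by
    have h := (hS.hasSum.mapL (ContinuousLinearMap.apply ℝ (lp (fun _ : GPow k => ℝ) 2) η)).mapL (innerSL ℝ η)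
    simpa only [ContinuousLinearMap.apply_apply, innerSL_apply_apply] using h
  have hpow : ∀ n : ℕ, ⟪η, ((r • lazyOp k) ^ n) η⟫_ℝ = r ^ n * ⟪η, (lazyOp k ^ n) η⟫_ℝ := fun n => by
    rw [smul_pow, FunLike.coe_smul, Pi.smul_apply, real_inner_smul_right]
  simp_rw [hpow] at hSη
  have hnn : ∀ n : ℕ, 0 ≤ r ^ n * ⟪η, (lazyOp k ^ n) η⟫_ℝ := fun n => mul_nonneg (pow_nonneg hr0 n) (inner_lazyOp_pow_nonneg hk n η)
  have hle : ∀ n : ℕ, r ^ n * ⟪η, (lazyOp k ^ n) η⟫_ℝ ≤ ⟪η, (lazyOp k ^ n) η⟫_ℝ := fun n =>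
    mul_le_of_le_one_left (inner_lazyOp_pow_nonneg hk n η) (pow_le_one₀ hr0 hr1.le)
  rw [inverse_greenReg hk hc hm, FunLike.coe_smul, Pi.smul_apply, real_inner_smul_right, ← hSη.tsum_eq,
    ENNReal.ofReal_mul (by positivity), ENNReal.ofReal_tsum_of_nonneg hnn hSη.summable, greenForm_eq_tsum_inner]
  have hcm' : ENNReal.ofReal (c + m)⁻¹ ≤ ENNReal.ofReal c⁻¹ := ENNReal.ofReal_le_ofReal (inv_anti₀ hc (by linarith))
  exact mul_le_mul' hcm' (ENNReal.tsum_le_tsum fun n => ENNReal.ofReal_le_ofReal (hle n))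

/-! ## §3 The `θ ↓ 0` bookkeeping in `ℝ≥0∞` (critic P-37-b (i)) -/

/-- If `x ≤ ofReal (C/(1−θ)) · G` for every `θ ∈ (0,1)` then `x ≤ ofReal C · G` (`C > 0`; `G = 0, ⊤` included). [folklore] -/
theorem le_mul_of_forall_lt_one {x G : ℝ≥0∞} {C : ℝ} (hC : 0 < C) (h : ∀ θ : ℝ, 0 < θ → θ < 1 → x ≤ ENNReal.ofReal (C / (1 - θ)) * G) :
    x ≤ ENNReal.ofReal C * G := by
  refine ENNReal.le_of_forall_lt_one_mul_le fun a ha => ?_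
  rcases eq_or_ne a 0 with ha0 | ha0
  · rw [ha0, zero_mul]; exact zero_le
  have hatop : a ≠ ⊤ := ne_top_of_lt ha
  set s : ℝ := a.toReal with hs
  have has : a = ENNReal.ofReal s := (ENNReal.ofReal_toReal hatop).symm
  have hs0 : 0 < s := ENNReal.toReal_pos ha0 hatop
  have hs1 : s < 1 := by
    have := (ENNReal.toReal_lt_toReal hatop ENNReal.one_ne_top).2 ha
    simpa using this
  have hθ := h (1 - s) (by linarith) (by linarith)
  rw [sub_sub_cancel] at hθ
  calc a * x ≤ a * (ENNReal.ofReal (C / s) * G) := by gcongr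
    _ = ENNReal.ofReal C * G := by
        rw [← mul_assoc, has, ← ENNReal.ofReal_mul hs0.le, show s * (C / s) = C by field_simp]

end NcHaraSlade

end Grigorchuk

end Summit.CriticalPhenomena.PercolationContinuityZ3.Theorems.Transplant

end
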